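import Literature.AlgebraicGeometry.Motives.GroupObjectSumMaps
import Literature.AlgebraicGeometry.Limits.SurjectiveSpread
import Literature.AlgebraicGeometry.AbelianSchemes.AbelianSchemeFibreEndomorphisms
import HarnessLib

/-!
# Generation spreads from the generic fibre of an abelian scheme to every fibre
# (III-0 road (R-bc), steps (S3)–(S4): Serre's sum maps + «surjectivity spreads from a generising base change»)

Topic `Literature/AlgebraicGeometry/AbelianSchemes`, namespace `Literature.AlgebraicGeometry.AbelianSchemes`.
Cell `hodgecm-mathlib`, fan A row III-0 (A-p14's road memo `ROAD-III0-albanese-baseChange.md`, SPEC-III0-pieces §F5):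
the middle block of the assembly `dim J(Y_ℂ) ≤ dim J(Y_k)`, extracted as one lemma so that the assembly only composes
named statements.

SETTING.  `T` a domain, `𝒜` an abelian scheme over `Spec T`, `X → Spec T` PROPER, `F : X ⟶ 𝒜.X` a morphism of
`T`-schemes, `ψ : T → K` an INJECTIVE ring map to a field (the generic geometric fibre, e.g. `T ⊆ ℂ`).

MAIN (`AbelianScheme.generates_fibre_of_generates_fibre_of_injective`).  If the base change `F_K : X_K → 𝒜_K` GENERATES
the abelian variety `𝒜_K = 𝒜.fibre ψ` (some Serre sum map `s_n(F_K) : (X_K × X_K)^{n+1} → 𝒜_K` is surjective), then for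
EVERY ring map `φ : T → L` to a field the base change `F_L : X_L → 𝒜_L = 𝒜.fibre φ` generates `𝒜_L`, with the same `n`.
Proof: `s_n(F_K) = s_n(F) ×_T K` up to the monoidal structure isomorphism (F1, `GroupObjectSumMaps`), so `s_n(F) ×_T K` is
surjective; `𝒜 → Spec T` is flat (smooth), `s_n(F)` is universally closed (its source `(X ×_T X)^{n+1}` is proper over
`Spec T` and `𝒜` is separated over `Spec T`), and `Spec K → Spec T` hits the generic point (ψ injective), so `s_n(F)` itself is
surjective (F4a, `Limits.surjective_left_of_surjective_pullback_map_left`); surjectivity is stable under the base change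
`Spec L → Spec T` (F1 `surjective_pmSumGrp_pullback_left`), and over the field `L` this is `Generates F_L`.

THEOREMS ONLY (no `def`, no named fact, no instance declared); every ingredient is a tree theorem (F1 p610534, F4 p610548).

## References

* [Serre1958MorphismesUniversels] J.-P. Serre, *Morphismes universels et variété d'Albanese*, Sém. Chevalley 1958/59,
  exp. 10, no. 1 (the maps `f_n`, Déf. 1 «f engendre A»), no. 2 (proof of Thm. 2: behaviour under extension of the base).
* [EGAIV2] A. Grothendieck, *EGA IV₂*, Prop. 2.3.4 (flat morphisms are generising), Cor. 2.3.12.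
* [GortzWedhorn2020] U. Görtz, T. Wedhorn, *Algebraic Geometry I* (2nd ed.), Prop. 4.32 (surjective is stable under base
  change), Remark 16.54 (abelian schemes).
-/

noncomputable section

universe u

open CategoryTheory CategoryTheory.Limits AlgebraicGeometry MonoidalCategory CartesianMonoidalCategory

namespace Literature.AlgebraicGeometry.AbelianSchemes

open Literature.AlgebraicGeometry.Motives Literature.AlgebraicGeometry.Limits
open scoped MonObj Obj

namespace AbelianScheme

variable {T : Type u} [CommRing T]

/-- Products of proper `T`-schemes are proper over `Spec T`: `(X ×_T Y → Spec T) = pr₁ ≫ (X → Spec T)` with `pr₁` a base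
change of the proper `Y → Spec T`. [cite: GortzWedhorn2020, Prop. 12.58 / Remark 16.54 (properness is stable under base change and composition)] -/
theorem isProper_tensorObj_hom (X Y : SchemeOver T) [IsProper X.hom] [IsProper Y.hom] : IsProper (X ⊗ Y).hom := by
  change IsProper (pullback.fst X.hom Y.hom ≫ X.hom)
  infer_instance

/-- The source `(X ×_T X)^{⊗(n+1)}` of Serre's `n`-th sum map is proper over `Spec T` when `X` is.
[cite: Serre1958MorphismesUniversels, no. 1] [cite: GortzWedhorn2020, Prop. 12.58] -/
theorem isProper_pmPowObj_hom (X : SchemeOver T) [IsProper X.hom] : ∀ n : ℕ, IsProper (pmPowObj X n).hom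
  | 0 => isProper_tensorObj_hom X X
  | n + 1 => by
    haveI := isProper_pmPowObj_hom X n
    haveI := isProper_tensorObj_hom X X
    exact isProper_tensorObj_hom (pmPowObj X n) (X ⊗ X)

/-- A morphism of `T`-schemes from a proper `T`-scheme to an abelian scheme is universally closed (the composite with the
separated `𝒜 → Spec T` is the proper structure map of the source). [cite: GortzWedhorn2020, Remark 16.54 and Prop. 12.58] -/
theorem universallyClosed_left_of_isProper (𝒜 : AbelianScheme T) {W : SchemeOver T} [IsProper W.hom] (s : W ⟶ 𝒜.X) :
    UniversallyClosed s.left := by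
  haveI : IsProper 𝒜.X.hom := 𝒜.isProper
  haveI : IsProper (s.left ≫ 𝒜.X.hom) := by rw [Over.w s]; infer_instance
  haveI : UniversallyClosed (s.left ≫ 𝒜.X.hom) := inferInstance
  exact UniversallyClosed.of_comp_of_isSeparated s.left 𝒜.X.hom

/-- **Surjectivity of a Serre sum map spreads from the generic geometric fibre.**  `T` a domain, `ψ : T → K` injective
into a field, `𝒜` an abelian scheme over `T`, `X` proper over `T`, `F : X ⟶ 𝒜.X`: if `s_n(F_K)` is surjective then
`s_n(F)` is surjective (flat target, universally closed map, generising base change).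
[cite: EGAIV2, Prop. 2.3.4 and Cor. 2.3.12] [cite: Serre1958MorphismesUniversels, no. 1] -/
theorem surjective_pmSumGrp_left_of_surjective_fibre [IsDomain T] {K : Type u} [Field K] (ψ : T →+* K)
    (hψ : Function.Injective ψ) (𝒜 : AbelianScheme T) {X : SchemeOver T} [IsProper X.hom] (F : X ⟶ 𝒜.X) (n : ℕ)
    [Surjective (pmSumGrp ((Over.pullback (specMap ψ)).map F) n).left] : Surjective (pmSumGrp F n).left := by
  haveI : Surjective ((Over.pullback (specMap ψ)).map (pmSumGrp F n)).left :=
    (surjective_pullback_map_pmSumGrp_left_iff (specMap ψ) F n).1 ‹_›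
  haveI : Smooth 𝒜.X.hom := 𝒜.isSmooth
  haveI : Flat 𝒜.X.hom := inferInstance
  haveI : IsProper (pmPowObj X n).hom := isProper_pmPowObj_hom X n
  haveI : UniversallyClosed (pmSumGrp F n).left := universallyClosed_left_of_isProper 𝒜 _
  exact surjective_left_of_surjective_pullback_map_left (specMap ψ) (pmSumGrp F n)
    (forall_exists_specializes_of_injective ψ hψ)

/-- **Generation spreads from the generic fibre to every fibre.**  `T` a domain, `ψ : T → K` an injective ring map to a
field, `𝒜` an abelian scheme over `T`, `X` a proper `T`-scheme and `F : X ⟶ 𝒜.X` over `T`.  If the base change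
`F_K : X_K → 𝒜_K` generates the abelian variety `𝒜_K = 𝒜.fibre ψ` (Serre: some sum map `s_n(F_K)` is surjective), then for
every ring map `φ : T → L` to a field, `F_L : X_L → 𝒜_L = 𝒜.fibre φ` generates `𝒜_L` — «`f` engendre `A`» specialises from the
generic geometric fibre to all fibres. [cite: Serre1958MorphismesUniversels, no. 1 Déf. 1 and no. 2 (proof of Thm. 2)] [cite: EGAIV2, Prop. 2.3.4] -/
theorem generates_fibre_of_generates_fibre_of_injective [IsDomain T] {K : Type u} [Field K] (ψ : T →+* K)
    (hψ : Function.Injective ψ) (𝒜 : AbelianScheme T) {X : SchemeOver T} [IsProper X.hom] (F : X ⟶ 𝒜.X)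
    (hgen : Generates (A := 𝒜.fibre ψ) ((Over.pullback (specMap ψ)).map F))
    {L : Type u} [Field L] (φ : T →+* L) :
    Generates (A := 𝒜.fibre φ) ((Over.pullback (specMap φ)).map F) := by
  obtain ⟨n, hn⟩ := (generates_iff_exists_surjective_pmSumGrp (A := 𝒜.fibre ψ) _).1 hgen
  haveI : Surjective (pmSumGrp ((Over.pullback (specMap ψ)).map F) n).left := hn
  haveI : Surjective (pmSumGrp F n).left := surjective_pmSumGrp_left_of_surjective_fibre ψ hψ 𝒜 F n
  exact (generates_iff_exists_surjective_pmSumGrp (A := 𝒜.fibre φ) _).2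
    ⟨n, surjective_pmSumGrp_pullback_left (specMap φ) F n⟩

end AbelianScheme

end Literature.AlgebraicGeometry.AbelianSchemes

end
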